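import Literature.NumberTheory.Irrationality.Zudilin2014.FirstTaleNewton
import Summits.KontsevichZagierPeriods.Zeta5Search.TwoTaleP15FirstTale
import Summits.KontsevichZagierPeriods.Zeta5Search.Denom.TwoTaleP15Decay
import Summits.KontsevichZagierPeriods.Zeta5Search.Denom.TwoTaleP15Bridge

/-!
# The two-tale point P15: the algebraic half of the line representation (E3, algebra)

HONEST FRAMING: systematic search; no irrationality claim unless certified.

Cell pub-zeta5, T3 service (P1 g9) for fam-denom's `Denom.TwoTaleP15Decay.LineRep`.  Over `ℂ`, at the point P15
(`a₂* = 11n+1`, `d = 16n−1`, poles `k ∈ [15n+1, 26n+2)`):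

* `ratRC_eq_aeval` — fam-denom's explicit complex `ratRC n s` IS `Π(a,b)·num(s)/den(s)` of the tree's first tale
  (`Zudilin2014.Pi/num/den` at `aP15 n, bP15 n`, evaluated by `aeval`);
* **`ratRC_shift_eq`** — for every `t : ℂ` off the poles,
  `ratRC n (t − (11n+1)) = Σ_{k ∈ [15n+1, 26n+2)} C_k/(t − (11n+1) + k) + Σ_{ℓ < 16n} A_ℓ · (∏_{j<ℓ} (t−1−j))/ℓ!`
  with `C_k = Zudilin2014.coefC (aP15 n) (bP15 n) k`, `A_ℓ = Zudilin2014.coefA (aP15 n) (bP15 n) ℓ` (cast `ℚ → ℂ`);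
  the last factor is fam-denom's `barnesP ℓ t = (t−1)⋯(t−ℓ)/ℓ!` unfolded [Zudilin2014ZetaTwo, eq. (P1)–(P3)].
Ingredients: the polynomial identity `FirstTaleNewton.Pi_mul_num_eq` and the Newton expansion
`FirstTaleNewton.polyP_newton`, transported to `ℂ` by `aeval`.  With fam-denom's Lemma 1 / Lemma 2 moments
(`KernelBinomialMoment`, `KernelPolarMoment`) and linearity this is `LineRep`; nothing here involves an integral.
-/

noncomputable section

namespace Summit.KontsevichZagierPeriods.Zeta5Search.TwoTaleP15

open Finset Polynomial
open Literature.NumberTheory.Irrationality.Zudilin2014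
open Denom.TwoTaleP15Decay (ratRC)

/-! ### Blocks over `ℂ` -/

/-- `aeval s (block lo hi) = ∏_{i ∈ [lo,hi)} (s + i)` in `ℂ`. -/
theorem aeval_block (lo hi : ℤ) (s : ℂ) : aeval s (block lo hi) = ∏ i ∈ Ico lo hi, (s + (i : ℂ)) := by
  unfold block
  rw [map_prod]
  refine prod_congr rfl fun i _ => ?_
  simp

/-- Reindexing an integer interval with natural end-points over `ℂ`. -/
theorem prod_Ico_intCast (lo hi : ℕ) (s : ℂ) :
    ∏ i ∈ Ico (lo : ℤ) (hi : ℤ), (s + (i : ℂ)) = ∏ i ∈ Ico lo hi, (s + (i : ℂ)) := by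
  rw [Denom.TwoTaleP15Bridge.Ico_natCast_eq_map, prod_map]
  refine prod_congr rfl fun i _ => ?_
  simp

/-- `Π(a,b)` at P15: `(11n)!/((13n)!(9n)!(5n)!)`. -/
theorem Pi_P15 (n : ℕ) :
    Pi (aP15 n) (bP15 n) = (Nat.factorial (11 * n) : ℚ) /
      ((Nat.factorial (13 * n) : ℚ) * Nat.factorial (9 * n) * Nat.factorial (5 * n)) := by
  unfold Pi numFac facZ
  have e3 : (bP15 n 3 - aP15 n 3 - 1).toNat = 11 * n := by simp; omega
  have e0 : (aP15 n 0 - bP15 n 0).toNat = 13 * n := by simp; omega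
  have e1 : (aP15 n 1 - bP15 n 1).toNat = 9 * n := by simp; omega
  have e2 : (aP15 n 2 - bP15 n 2).toNat = 5 * n := by simp; omega
  rw [e3, e0, e1, e2]

/-- **`ratRC` is the tree's `Π·num/den` at P15**, as complex functions (both sides are `0` at the poles). -/
theorem ratRC_eq_aeval (n : ℕ) (s : ℂ) :
    ratRC n s = ((Pi (aP15 n) (bP15 n) : ℚ) : ℂ) * aeval s (num (aP15 n) (bP15 n)) /
      aeval s (den (aP15 n) (bP15 n)) := by
  unfold ratRC num den
  rw [map_mul, map_mul, aeval_block, aeval_block, aeval_block, aeval_block, Pi_P15]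
  have h0 : ∏ i ∈ Ico (bP15 n 0) (aP15 n 0), (s + (i : ℂ)) = ∏ i ∈ Ico 1 (13 * n + 1), (s + (i : ℂ)) := by
    rw [show bP15 n 0 = ((1 : ℕ) : ℤ) by simp, show aP15 n 0 = ((13 * n + 1 : ℕ) : ℤ) by push_cast; simp,
      prod_Ico_intCast]
  have h1 : ∏ i ∈ Ico (bP15 n 1) (aP15 n 1), (s + (i : ℂ)) = ∏ i ∈ Ico (2 * n + 1) (11 * n + 1), (s + (i : ℂ)) := by
    rw [show bP15 n 1 = ((2 * n + 1 : ℕ) : ℤ) by push_cast; simp,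
      show aP15 n 1 = ((11 * n + 1 : ℕ) : ℤ) by push_cast; simp, prod_Ico_intCast]
  have h2 : ∏ i ∈ Ico (bP15 n 2) (aP15 n 2), (s + (i : ℂ)) = ∏ i ∈ Ico (4 * n + 1) (9 * n + 1), (s + (i : ℂ)) := by
    rw [show bP15 n 2 = ((4 * n + 1 : ℕ) : ℤ) by push_cast; simp,
      show aP15 n 2 = ((9 * n + 1 : ℕ) : ℤ) by push_cast; simp, prod_Ico_intCast]
  have h3 : ∏ i ∈ Ico (aP15 n 3) (bP15 n 3), (s + (i : ℂ)) = ∏ i ∈ Ico (15 * n + 1) (26 * n + 2), (s + (i : ℂ)) := by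
    rw [show aP15 n 3 = ((15 * n + 1 : ℕ) : ℤ) by push_cast; simp,
      show bP15 n 3 = ((26 * n + 2 : ℕ) : ℤ) by push_cast; simp, prod_Ico_intCast]
  rw [h0, h1, h2, h3]
  have f13 : (Nat.factorial (13 * n) : ℂ) ≠ 0 := by exact_mod_cast (Nat.factorial_pos _).ne'
  have f9 : (Nat.factorial (9 * n) : ℂ) ≠ 0 := by exact_mod_cast (Nat.factorial_pos _).ne'
  have f5 : (Nat.factorial (5 * n) : ℂ) ≠ 0 := by exact_mod_cast (Nat.factorial_pos _).ne'
  by_cases hD : ∏ i ∈ Ico (15 * n + 1) (26 * n + 2), (s + (i : ℂ)) = 0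
  · rw [hD]; simp
  · push_cast
    field_simp

/-! ### The identity -/

/-- The pole range at P15. -/
theorem Ico_a3_P15 (n : ℕ) : Ico (aP15 n 3) (bP15 n 3) = Ico (15 * (n : ℤ) + 1) (26 * n + 2) := by simp

/-- `aeval` of the Newton basis: `P_ℓ(t) = (∏_{j<ℓ} (t − 1 − j))/ℓ!` over `ℂ`. -/
theorem aeval_newtonP (ℓ : ℕ) (t : ℂ) :
    aeval t (newtonP ℓ) = (∏ j ∈ range ℓ, (t - 1 - j)) / (ℓ.factorial : ℂ) := by
  unfold newtonP
  rw [map_mul, aeval_C, aeval_comp, map_sub, aeval_X, aeval_C, aeval_def, ← eval_map, descPochhammer_map,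
    descPochhammer_eval_eq_prod_range]
  simp [div_eq_inv_mul]

/-- **E3 (algebraic half) at P15** [Zudilin2014ZetaTwo, eq. (P1)–(P3)]: for every complex `t` off the poles,
`R(t − a₂*) = Σ_k C_k/(t − a₂* + k) + Σ_{ℓ=0}^{d} A_ℓ P_ℓ(t)` with `a₂* = 11n+1`, `d = 16n−1`,
`P_ℓ(t) = (t−1)⋯(t−ℓ)/ℓ!`, and the tree's `C_k = coefC`, `A_ℓ = coefA` at `aP15 n, bP15 n`. -/
theorem ratRC_shift_eq {n : ℕ} (hn : 1 ≤ n) (t : ℂ)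
    (ht : ∀ k ∈ Ico (15 * (n : ℤ) + 1) (26 * n + 2), t - (11 * n + 1) + (k : ℂ) ≠ 0) :
    ratRC n (t - (11 * n + 1)) =
      ∑ k ∈ Ico (15 * (n : ℤ) + 1) (26 * n + 2),
          ((coefC (aP15 n) (bP15 n) k : ℚ) : ℂ) / (t - (11 * n + 1) + k)
        + ∑ ℓ ∈ range (16 * n),
          ((coefA (aP15 n) (bP15 n) ℓ : ℚ) : ℂ) * ((∏ j ∈ range ℓ, (t - 1 - j)) / (ℓ.factorial : ℂ)) := by
  set s : ℂ := t - (11 * n + 1) with hs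
  have hadm := admissible hn
  -- the polynomial identity (P1) transported to ℂ
  have hid := congrArg (aeval s) (Pi_mul_num_eq hadm)
  simp only [map_mul, map_add, map_sum, aeval_C] at hid
  have hden_fac : ∀ k ∈ Ico (aP15 n 3) (bP15 n 3),
      aeval s (den (aP15 n) (bP15 n)) = (s + k) * aeval s (denErase (aP15 n) (bP15 n) k) := by
    intro k hk
    rw [den_eq_mul_denErase hk, map_mul, map_add, aeval_X, aeval_C]
    simp
  have hden : aeval s (den (aP15 n) (bP15 n)) ≠ 0 := by
    unfold den
    rw [aeval_block, Ico_a3_P15]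
    exact prod_ne_zero_iff.2 fun k hk => ht k hk
  have hE : ∀ k ∈ Ico (aP15 n 3) (bP15 n 3), aeval s (denErase (aP15 n) (bP15 n) k) ≠ 0 := by
    intro k hk h0
    exact hden (by rw [hden_fac k hk, h0, mul_zero])
  -- R = P + Σ C_k/(s+k)
  have hR : ratRC n s = aeval s (polyP (aP15 n) (bP15 n)) +
      ∑ k ∈ Ico (aP15 n 3) (bP15 n 3), ((coefC (aP15 n) (bP15 n) k : ℚ) : ℂ) / (s + k) := by
    rw [ratRC_eq_aeval, div_eq_iff hden]
    simp only [eq_ratCast] at hid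
    rw [hid, add_mul, sum_mul]
    congr 1
    refine sum_congr rfl fun k hk => ?_
    rw [hden_fac k hk]
    have hsk : s + k ≠ 0 := by rw [Ico_a3_P15] at hk; exact ht k hk
    field_simp
  -- P(s) = P(t − a₂*) = Σ A_ℓ P_ℓ(t)
  have hP : aeval s (polyP (aP15 n) (bP15 n)) =
      ∑ ℓ ∈ range (16 * n), ((coefA (aP15 n) (bP15 n) ℓ : ℚ) : ℂ) * ((∏ j ∈ range ℓ, (t - 1 - j)) / (ℓ.factorial : ℂ)) := by
    have hcomp : aeval s (polyP (aP15 n) (bP15 n)) =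
        aeval t ((polyP (aP15 n) (bP15 n)).comp (X - C (a2star (aP15 n) : ℚ))) := by
      rw [aeval_comp, map_sub, aeval_X, aeval_C, a2star_eq]
      congr 1
      rw [hs]; push_cast; simp
    rw [hcomp, polyP_newton hadm, dExp_eq, show 16 * n - 1 + 1 = 16 * n by omega, map_sum]
    refine sum_congr rfl fun ℓ _ => ?_
    rw [map_mul, aeval_C, aeval_newtonP]
    simp
  rw [hR, hP, Ico_a3_P15, add_comm]

end Summit.KontsevichZagierPeriods.Zeta5Search.TwoTaleP15

end
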